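import Mathlib
import HarnessLib
import Summits.NavierStokesRegularity.NavierStokesRegularity.Theorems.PoloidalWindowDoorPoloidalWindowRigidityHullBirkhoffPair
import Summits.NavierStokesRegularity.NavierStokesRegularity.Theorems.PoloidalWindowDoorLrcModEntireRidgeWebRecurrentSlide
import Summits.NavierStokesRegularity.NavierStokesRegularity.Theorems.PoloidalWindowDoorPoloidalWindowRigidityHotHullSlabUniform
import Summits.NavierStokesRegularity.NavierStokesRegularity.Theorems.PoloidalWindowDoorPoloidalWindowRigidityLeafUniformPins

/-!
# Item `LrcModEntire` (stmt-NavierStokesRegularity-20428) / crux `PoloidalWindowRigidity` (19708) — THE BRANCH HULL and its UNIFORMLY RECURRENT MEMBER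
# (DIRECTOR-NS #301 (A)(1): the recurrent upgrade of the (Q4) object; LEAD K2-p3 g15 WANTED 11:58:41Z)

Seat ns-poloidal-K2-p2 g15 (`--supports stmt-NavierStokesRegularity-19708 --as helper`).

* `exists_uniformlyRecurrent_branchPair` — hypotheses = port-2's `…RidgeHullIterate.exists_hullLimit_branch_reentry` (pinned peakless class profile `v`
  VERBATIM unfolded, a complete `C²` unit-speed hot branch `γ ⊂ P₀` with uniform transversal non-degeneracy `κ₀ > 0`), no base sequence.  Conclusion: a base
  sequence `sq` and a pair `(U, Γ)` in the BRANCH HULL of `(v, γ)` — `v(·, · + γ(sq j)) → U` slice-wise locally uniformly, `γ(sq j + ·) − γ(sq j) → Γ` locally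
  uniformly — with `U` pinned, peakless, same hot value, port-2's RE-ENTRY PACKAGE for `(U, Γ)`, which is UNIFORMLY RECURRENT UNDER SLIDING ALONG ITS OWN
  BRANCH: for every `ε > 0` and slab index `n` the set of `σ'` with `U(·, · + Γ σ')` `ε`-close to `U` on `[−(n+2), −(n+2)⁻¹] × B̄_{n+2}` and
  `Γ(· + σ') − Γ σ'` `ε`-close to `Γ` on `[−(n+2), n+2]` is relatively dense.

PROOF.  Phase space `Ω(v, γ)` := pairs `(U, x ↦ Γ(x 0))` with the package above AND a witnessing base sequence (hull membership); it is non-empty (the hull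
step at base `0`, `exists_hullLimit_branch_reentry` with `sq ≡ 0`), consists of class profiles with continuous tags, is invariant under the slide
(`…RecurrentSlide.reentry_slide` + the slid witnesses `s_k + σ'`, `tendstoLocallyUniformly_comp_add`), the slide is an action (`slide_add`) and sequentially
continuous, and `Ω` is SEQUENTIALLY COMPACT-AND-CLOSED: given members `(U_k, Γ_k)` choose DIAGONALLY a slide of `(v, γ)` `1/(k+1)`-close to `(U_k, Γ_k)` on slab `k`
(slab-uniform convergence `…HotHullSlabUniform.tendstoUniformlyOn_slab` of the witnesses), run the hull step `exists_hullLimit_branch_reentry` along the chosen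
base points (it delivers the limit pair WITH its package), upgrade the pointwise convergence of the re-based branches to locally uniform (they are `1`-Lipschitz:
`tendstoLocallyUniformly_of_lipschitz_tendsto`), and return by the triangle inequality.  Then `…HullBirkhoffPair.exists_recurrent_of_pairAction`.

WHAT THIS IS NOT: not a claim about Navier–Stokes regularity — a support theorem for the (TH)/(Q4) sub-cell of a door route (bears_on LADDER-NS N0, item 20428 /
crux 19708; both OPEN; the research cell (Q4) «value-homogeneous + uniformly recurrent null ridge» OPEN; NS regularity NOT proved).
-/

noncomputable section

-- the summit and its single sub-problem share the name (CONVENTIONS §1), as in every Theorems file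
set_option linter.dupNamespace false

namespace Summit.NavierStokesRegularity.NavierStokesRegularity.Theorems.PoloidalWindowDoorLrcModEntireRidgeWebRecurrentHull

open Set Function Filter Topology Metric
open scoped InnerProductSpace RealInnerProductSpace Laplacian NNReal ContDiff
open Literature.Analysis Literature.Analysis.FluidPDE Literature.Analysis.UnboundedOperators
open Summit.NavierStokesRegularity.NavierStokesRegularity.Theorems
open PoloidalWindowDoorPoloidalWindowRigidityHotHullCompactness PoloidalWindowDoorPoloidalWindowRigidityHotHullSliding
  PoloidalWindowDoorPoloidalWindowRigidityHotHullSlabUniform PoloidalWindowDoorPoloidalWindowRigidityHullBirkhoffPair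
  PoloidalWindowDoorLrcModEntireRidgeHullIterate PoloidalWindowDoorLrcModEntireRidgeWebRecurrentSlide

/-- **The branch hull of `(v, γ)` has a uniformly recurrent member.**  See the module docstring. -/
theorem exists_uniformlyRecurrent_branchPair (C : ℝ) (v : ℝ → EuclideanSpace ℝ (Fin 3) → EuclideanSpace ℝ (Fin 3))
    (hP : (Literature.Analysis.FluidPDE.HasTypeITimeDecay C v ∧
        ContinuousOn (Function.uncurry v) (Set.Iio (0 : ℝ) ×ˢ Set.univ) ∧
        (∀ s t : ℝ, s < t → t < 0 → ∀ x, v t x =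
          Literature.Analysis.UnboundedOperators.heatExtension (v s) (t - s) x -
            Literature.Analysis.FluidPDE.oseenDuhamel 1 s v v t x) ∧
        (∀ t < 0, Literature.Analysis.FluidPDE.VectorCalculus.IsDivFree (v t)) ∧
        (∀ s < 0, ∀ q, ⟪Literature.Analysis.FluidPDE.curl (v s) q, EuclideanSpace.single 2 1⟫_ℝ = 0) ∧
        v (-1) 0 2 ≠ 0 ∧ (∀ t < 0, ∀ x, Real.sqrt (-t) * |v t x 2| ≤ |v (-1) 0 2|) ∧
        (∀ h : EuclideanSpace ℝ (Fin 3), fderiv ℝ (v (-1)) 0 h 2 = 0) ∧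
        (deriv (fun s => v s 0 2) (-1) = v (-1) 0 2 / 2 ∧ v (-1) 0 2 * (Δ (fun q => v (-1) q 2)) 0 ≤ 0)))
    (hK : (∀ (s z₀ σ M : ℝ) (K O : Set (EuclideanSpace ℝ (Fin 3))), s < 0 →
        ((σ = 1 ∨ σ = -1) ∧ IsCompact K ∧ K.Nonempty ∧ (∀ q ∈ K, q 2 = z₀ ∧ σ * v s q 2 = M) ∧
          IsOpen O ∧ K ⊆ O ∧ (∀ q ∈ O, q 2 = z₀ → σ * v s q 2 ≤ M) ∧
          (∀ q ∈ O, q 2 = z₀ → σ * v s q 2 = M → q ∈ K)) → False))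
    {σ : ℝ} (hσ : σ = 1 ∨ σ = -1)
    {γ : ℝ → EuclideanSpace ℝ (Fin 3)} (hγ2 : ContDiff ℝ 2 γ) (hplane : ∀ s, γ s 2 = 0) (hunit : ∀ s, ‖deriv γ s‖ = 1)
    (hhot : ∀ s, v (-1) (γ s) 2 = v (-1) 0 2)
    {ν : ℝ → EuclideanSpace ℝ (Fin 3)} (hν : ∀ s, ν s = WithLp.toLp 2 ![-(deriv γ s 1), deriv γ s 0, 0])
    {κ₀ : ℝ} (hκ₀ : 0 < κ₀) (hκ : ∀ s, κ₀ ≤ -(fderiv ℝ (fderiv ℝ (fun y => σ * v (-1) y 2)) (γ s) (ν s) (ν s))) :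
    ∃ (sq : ℕ → ℝ) (U : ℝ → EuclideanSpace ℝ (Fin 3) → EuclideanSpace ℝ (Fin 3)) (Γ : ℝ → EuclideanSpace ℝ (Fin 3)),
      (Literature.Analysis.FluidPDE.HasTypeITimeDecay C U ∧
        ContinuousOn (Function.uncurry U) (Set.Iio (0 : ℝ) ×ˢ Set.univ) ∧
        (∀ s t : ℝ, s < t → t < 0 → ∀ x, U t x =
          Literature.Analysis.UnboundedOperators.heatExtension (U s) (t - s) x -
            Literature.Analysis.FluidPDE.oseenDuhamel 1 s U U t x) ∧
        (∀ t < 0, Literature.Analysis.FluidPDE.VectorCalculus.IsDivFree (U t)) ∧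
        (∀ s < 0, ∀ q, ⟪Literature.Analysis.FluidPDE.curl (U s) q, EuclideanSpace.single 2 1⟫_ℝ = 0) ∧
        U (-1) 0 2 ≠ 0 ∧ (∀ t < 0, ∀ x, Real.sqrt (-t) * |U t x 2| ≤ |U (-1) 0 2|) ∧
        (∀ h : EuclideanSpace ℝ (Fin 3), fderiv ℝ (U (-1)) 0 h 2 = 0) ∧
        (deriv (fun s => U s 0 2) (-1) = U (-1) 0 2 / 2 ∧ U (-1) 0 2 * (Δ (fun q => U (-1) q 2)) 0 ≤ 0)) ∧
      (∀ (s z₀ σ M : ℝ) (K O : Set (EuclideanSpace ℝ (Fin 3))), s < 0 →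
        ((σ = 1 ∨ σ = -1) ∧ IsCompact K ∧ K.Nonempty ∧ (∀ q ∈ K, q 2 = z₀ ∧ σ * U s q 2 = M) ∧
          IsOpen O ∧ K ⊆ O ∧ (∀ q ∈ O, q 2 = z₀ → σ * U s q 2 ≤ M) ∧
          (∀ q ∈ O, q 2 = z₀ → σ * U s q 2 = M → q ∈ K)) → False) ∧
      U (-1) 0 2 = v (-1) 0 2 ∧
      (∀ t < 0, TendstoLocallyUniformly (fun j x => v t (x + γ (sq j))) (U t) atTop) ∧
      TendstoLocallyUniformly (fun j s => γ (sq j + s) - γ (sq j)) Γ atTop ∧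
      ((∀ y ∈ {y : EuclideanSpace ℝ (Fin 3) | y 2 = 0 ∧ U (-1) y 2 = U (-1) 0 2}, fderiv ℝ (fun x => U (-1) x 2) y = 0) ∧
      ContDiff ℝ ∞ Γ ∧ Γ 0 = 0 ∧ (∀ s, Γ s 2 = 0) ∧ (∀ s, ‖deriv Γ s‖ = 1) ∧ (∀ s, U (-1) (Γ s) 2 = U (-1) 0 2) ∧
      (∀ s, κ₀ ≤ -(fderiv ℝ (fderiv ℝ (fun y => σ * U (-1) y 2)) (Γ s)
          (WithLp.toLp 2 ![-(deriv Γ s 1), deriv Γ s 0, 0]) (WithLp.toLp 2 ![-(deriv Γ s 1), deriv Γ s 0, 0])))) ∧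
      (∀ ε : ℝ, 0 < ε → ∀ n : ℕ, ∃ L : ℝ, 0 < L ∧ ∀ a : ℝ, ∃ σ' ∈ Icc a (a + L),
        (∀ t ∈ Icc (-((n : ℝ) + 2)) (-((n : ℝ) + 2)⁻¹), ∀ x ∈ closedBall (0 : EuclideanSpace ℝ (Fin 3)) ((n : ℝ) + 2),
          dist (U t (x + Γ σ')) (U t x) < ε) ∧
        (∀ s ∈ Icc (-((n : ℝ) + 2)) ((n : ℝ) + 2), dist (Γ (s + σ') - Γ σ') (Γ s) < ε)) := by
  classical
  have hneg : (-1 : ℝ) < 0 := by norm_num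
  obtain ⟨hrate, hcont, hmild, hdivf, hpol, hN, hpin, hgrad0, hpins⟩ := hP
  have hγd : Differentiable ℝ γ := hγ2.differentiable (by norm_num)
  have hGL : ∀ b : ℝ, LipschitzWith 1 (fun s => γ (b + s) - γ b) := fun b => lipschitzWith_one_rebased hγd hunit b
  -- class facts of the translates of `v`
  have hcT : ∀ y : EuclideanSpace ℝ (Fin 3), HasTypeITimeDecay C (fun t x => v t (x + y)) ∧
      ContinuousOn (uncurry fun t x => v t (x + y)) (Iio (0 : ℝ) ×ˢ univ) ∧
      (∀ s t : ℝ, s < t → t < 0 → ∀ x, (fun t x => v t (x + y)) t x =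
        heatExtension ((fun t x => v t (x + y)) s) (t - s) x - oseenDuhamel 1 s (fun t x => v t (x + y)) (fun t x => v t (x + y)) t x) ∧
      (∀ t < 0, VectorCalculus.IsDivFree ((fun t x => v t (x + y)) t)) := fun y => by
    obtain ⟨h1, h2, h3⟩ := PoloidalWindowDoorPoloidalWindowRigidityLeafUniformPins.class_translate hrate hcont hmild y
    exact ⟨h1, h2, h3, fun t ht => isDivFree_translate_arg (hdivf t ht) y⟩
  set e₀ : EuclideanSpace ℝ (Fin 3) := EuclideanSpace.single (0 : Fin 3) (1 : ℝ) with he₀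
  -- ## the branch hull `Ω(v, γ)` (pairs (profile, branch tag)) and the slide
  set Ω : Set ((ℝ → EuclideanSpace ℝ (Fin 3) → EuclideanSpace ℝ (Fin 3)) × (EuclideanSpace ℝ (Fin 3) → EuclideanSpace ℝ (Fin 3))) := {p | (Literature.Analysis.FluidPDE.HasTypeITimeDecay C p.1 ∧
        ContinuousOn (Function.uncurry p.1) (Set.Iio (0 : ℝ) ×ˢ Set.univ) ∧
        (∀ s t : ℝ, s < t → t < 0 → ∀ x, p.1 t x =
          Literature.Analysis.UnboundedOperators.heatExtension (p.1 s) (t - s) x -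
            Literature.Analysis.FluidPDE.oseenDuhamel 1 s p.1 p.1 t x) ∧
        (∀ t < 0, Literature.Analysis.FluidPDE.VectorCalculus.IsDivFree (p.1 t)) ∧
        (∀ s < 0, ∀ q, ⟪Literature.Analysis.FluidPDE.curl (p.1 s) q, EuclideanSpace.single 2 1⟫_ℝ = 0) ∧
        p.1 (-1) 0 2 ≠ 0 ∧ (∀ t < 0, ∀ x, Real.sqrt (-t) * |p.1 t x 2| ≤ |p.1 (-1) 0 2|) ∧
        (∀ h : EuclideanSpace ℝ (Fin 3), fderiv ℝ (p.1 (-1)) 0 h 2 = 0) ∧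
        (deriv (fun s => p.1 s 0 2) (-1) = p.1 (-1) 0 2 / 2 ∧ p.1 (-1) 0 2 * (Δ (fun q => p.1 (-1) q 2)) 0 ≤ 0)) ∧
      (∀ (s z₀ σ M : ℝ) (K O : Set (EuclideanSpace ℝ (Fin 3))), s < 0 →
        ((σ = 1 ∨ σ = -1) ∧ IsCompact K ∧ K.Nonempty ∧ (∀ q ∈ K, q 2 = z₀ ∧ σ * p.1 s q 2 = M) ∧
          IsOpen O ∧ K ⊆ O ∧ (∀ q ∈ O, q 2 = z₀ → σ * p.1 s q 2 ≤ M) ∧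
          (∀ q ∈ O, q 2 = z₀ → σ * p.1 s q 2 = M → q ∈ K)) → False) ∧
      p.1 (-1) 0 2 = v (-1) 0 2 ∧
      ∃ Γ : ℝ → EuclideanSpace ℝ (Fin 3), p.2 = (fun x => Γ (x 0)) ∧
        ((∀ y ∈ {y : EuclideanSpace ℝ (Fin 3) | y 2 = 0 ∧ p.1 (-1) y 2 = p.1 (-1) 0 2}, fderiv ℝ (fun x => p.1 (-1) x 2) y = 0) ∧
      ContDiff ℝ ∞ Γ ∧ Γ 0 = 0 ∧ (∀ s, Γ s 2 = 0) ∧ (∀ s, ‖deriv Γ s‖ = 1) ∧ (∀ s, p.1 (-1) (Γ s) 2 = p.1 (-1) 0 2) ∧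
      (∀ s, κ₀ ≤ -(fderiv ℝ (fderiv ℝ (fun y => σ * p.1 (-1) y 2)) (Γ s)
          (WithLp.toLp 2 ![-(deriv Γ s 1), deriv Γ s 0, 0]) (WithLp.toLp 2 ![-(deriv Γ s 1), deriv Γ s 0, 0])))) ∧
        ∃ s : ℕ → ℝ, (∀ t < 0, TendstoLocallyUniformly (fun k x => v t (x + γ (s k))) (p.1 t) atTop) ∧
          TendstoLocallyUniformly (fun k σ' => γ (s k + σ') - γ (s k)) Γ atTop} with hΩ
  set Φ : ℝ → (ℝ → EuclideanSpace ℝ (Fin 3) → EuclideanSpace ℝ (Fin 3)) × (EuclideanSpace ℝ (Fin 3) → EuclideanSpace ℝ (Fin 3)) → (ℝ → EuclideanSpace ℝ (Fin 3) → EuclideanSpace ℝ (Fin 3)) × (EuclideanSpace ℝ (Fin 3) → EuclideanSpace ℝ (Fin 3)) := fun σ' q =>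
    ((fun τ x => q.1 τ (x + q.2 (σ' • e₀)), fun x => q.2 (x + σ' • e₀) - q.2 (σ' • e₀)) : (ℝ → EuclideanSpace ℝ (Fin 3) → EuclideanSpace ℝ (Fin 3)) × (EuclideanSpace ℝ (Fin 3) → EuclideanSpace ℝ (Fin 3))) with hΦ
  -- bookkeeping on members
  have hcls4 : ∀ p ∈ Ω, HasTypeITimeDecay C p.1 ∧ ContinuousOn (uncurry p.1) (Iio (0 : ℝ) ×ˢ univ) ∧
      (∀ s t : ℝ, s < t → t < 0 → ∀ x, p.1 t x = heatExtension (p.1 s) (t - s) x - oseenDuhamel 1 s p.1 p.1 t x) ∧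
      (∀ t < 0, VectorCalculus.IsDivFree (p.1 t)) := fun p hp => ⟨hp.1.1, hp.1.2.1, hp.1.2.2.1, hp.1.2.2.2.1⟩
  have hcls : ∀ p ∈ Ω, IsTypeIAncientMild C p.1 := fun p hp =>
    PoloidalWindowDoorPoloidalWindowRigidityWindow.isTypeIAncientMild_of_class (hcls4 p hp).1 (hcls4 p hp).2.1 (hcls4 p hp).2.2.1 (hcls4 p hp).2.2.2
  have hslice : ∀ p ∈ Ω, ∀ t < 0, Continuous (p.1 t) := fun p hp t ht =>
    continuous_slice_of_class (hcls4 p hp).1 (hcls4 p hp).2.1 (hcls4 p hp).2.2.1 (hcls4 p hp).2.2.2 ht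
  have hobs : ∀ p ∈ Ω, Continuous p.2 := by
    rintro p ⟨-, -, -, Γ, hg, ⟨-, hΓs, -⟩, -⟩
    rw [hg]
    exact hΓs.continuous.comp (EuclideanSpace.proj (0 : Fin 3)).continuous
  -- ## (Ω1) non-empty: the hull step at base `0`
  have hne : Ω.Nonempty := by
    obtain ⟨φ0, U0, Γ0, -, hPK0, hPL0, hN0, hconv0, hpt0, -, -, hcrit0, hΓs0, hΓ00, hΓpl0, hΓun0, hΓhot0, hκ0⟩ :=
      exists_hullLimit_branch_reentry C v ⟨hrate, hcont, hmild, hdivf, hpol, hN, hpin, hgrad0, hpins⟩ hK hσ hγ2 hplane hunit hhot hν hκ₀ hκ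
        (fun _ => (0 : ℝ))
    have hbr0 : TendstoLocallyUniformly (fun k σ' => γ ((fun j => (fun _ : ℕ => (0 : ℝ)) (φ0 j)) k + σ') - γ ((fun j => (fun _ : ℕ => (0 : ℝ)) (φ0 j)) k)) Γ0 atTop :=
      tendstoLocallyUniformly_of_lipschitz_tendsto (fun k => hGL _) hpt0
    exact ⟨(U0, fun x => Γ0 (x 0)), hPK0, hPL0, hN0, Γ0, rfl, ⟨hcrit0, hΓs0, hΓ00, hΓpl0, hΓun0, hΓhot0, hκ0⟩, fun j => (fun _ : ℕ => (0 : ℝ)) (φ0 j),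
      hconv0, hbr0⟩
  -- ## (Ω2) invariance under the slide
  have hinv : ∀ p ∈ Ω, ∀ σ' : ℝ, Φ σ' p ∈ Ω := by
    rintro ⟨U, g⟩ ⟨hPK, hPL, hNU, Γ, hg, ⟨hcrit, hΓs, hΓ0, hΓpl, hΓun, hΓhot, hΓκ⟩, s, hsl, hbr⟩ σ'
    simp only at hPK hPL hNU hg hcrit hΓhot hΓκ hsl
    subst hg
    have hΦ1 : Φ σ' (U, fun x => Γ (x 0)) = ((fun t x => U t (x + Γ σ')), fun x => (fun s => Γ (s + σ') - Γ σ') (x 0)) := by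
      simp only [hΦ, Prod.mk.injEq]
      constructor
      · funext t x; simp [he₀]
      · funext x; simp [he₀]
    rw [hΦ1]
    obtain ⟨hPK', hPL', hN', hcrit', hΓs', hΓ0', hΓpl', hΓun', hΓhot', hΓκ'⟩ := reentry_slide hPK hPL hΓs hΓpl hΓun hΓhot hΓκ σ'
    have hUc : ∀ t < 0, Continuous (U t) := fun t ht => continuous_slice_of_class hPK.1 hPK.2.1 hPK.2.2.1 hPK.2.2.2.1 ht
    have hΓc : Continuous Γ := hΓs.continuous
    -- the slid witnesses
    have hck : Tendsto (fun k => γ (s k + σ') - γ (s k)) atTop (𝓝 (Γ σ')) := (tendstoLocallyUniformlyOn_univ.2 hbr).tendsto_at (mem_univ σ')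
    have hsl' : ∀ t < 0, TendstoLocallyUniformly (fun k x => v t (x + γ (s k + σ'))) ((fun t x => U t (x + Γ σ')) t) atTop := by
      intro t ht
      have h := tendstoLocallyUniformly_comp_add (hsl t ht) (hUc t ht) hck
      have e : (fun k x => (fun x => v t (x + γ (s k))) (x + (γ (s k + σ') - γ (s k)))) = fun k x => v t (x + γ (s k + σ')) := by
        funext k x
        simp only [add_assoc, sub_add_cancel]
      rw [e] at h
      exact h
    have hbr' : TendstoLocallyUniformly (fun k σ'' => γ ((s k + σ') + σ'') - γ (s k + σ')) (fun s => Γ (s + σ') - Γ σ') atTop := by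
      have h1 : TendstoLocallyUniformly (fun k σ'' => (fun σ'' => γ (s k + σ'') - γ (s k)) (σ'' + σ')) (fun σ'' => Γ (σ'' + σ')) atTop :=
        tendstoLocallyUniformly_comp_add hbr hΓc (tendsto_const_nhds (x := σ'))
      have h2 : TendstoLocallyUniformly (fun k (_ : ℝ) => γ (s k + σ') - γ (s k)) (fun _ => Γ σ') atTop :=
        (hck.tendstoUniformly_const).tendstoLocallyUniformly
      have h3 := h1.sub h2
      have e1 : ((fun k σ'' => (fun σ'' => γ (s k + σ'') - γ (s k)) (σ'' + σ')) - fun k (_ : ℝ) => γ (s k + σ') - γ (s k)) =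
          fun k σ'' => γ ((s k + σ') + σ'') - γ (s k + σ') := by
        funext k σ''
        simp only [Pi.sub_apply]
        rw [sub_sub_sub_cancel_right, show s k + (σ'' + σ') = s k + σ' + σ'' by ring]
      have e2 : ((fun σ'' => Γ (σ'' + σ')) - fun _ : ℝ => Γ σ') = fun s => Γ (s + σ') - Γ σ' := by
        funext σ''; simp only [Pi.sub_apply]
      rw [e1, e2] at h3
      exact h3
    exact ⟨hPK', hPL', hN'.trans hNU, fun s => Γ (s + σ') - Γ σ', rfl, ⟨hcrit', hΓs', hΓ0', hΓpl', hΓun', hΓhot', hΓκ'⟩, fun k => s k + σ', hsl', hbr'⟩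
  -- ## (Ω3) the slide is an action, sequentially continuous
  have hadd : ∀ p ∈ Ω, ∀ s t : ℝ, Φ (s + t) p = Φ s (Φ t p) := fun p _ s t => slide_add p s t
  have hcontΦ : ∀ σ' : ℝ, ∀ (ps : ℕ → (ℝ → EuclideanSpace ℝ (Fin 3) → EuclideanSpace ℝ (Fin 3)) × (EuclideanSpace ℝ (Fin 3) → EuclideanSpace ℝ (Fin 3))) (p : (ℝ → EuclideanSpace ℝ (Fin 3) → EuclideanSpace ℝ (Fin 3)) × (EuclideanSpace ℝ (Fin 3) → EuclideanSpace ℝ (Fin 3))), (∀ k, ps k ∈ Ω) → p ∈ Ω →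
      (∀ t < 0, TendstoLocallyUniformly (fun k => (ps k).1 t) (p.1 t) atTop) → TendstoLocallyUniformly (fun k => (ps k).2) p.2 atTop →
      (∀ t < 0, TendstoLocallyUniformly (fun k => (Φ σ' (ps k)).1 t) ((Φ σ' p).1 t) atTop) ∧
        TendstoLocallyUniformly (fun k => (Φ σ' (ps k)).2) (Φ σ' p).2 atTop := by
    intro σ' ps p hps hp hsl htag
    have hck : Tendsto (fun k => (ps k).2 (σ' • e₀)) atTop (𝓝 (p.2 (σ' • e₀))) :=
      (tendstoLocallyUniformlyOn_univ.2 htag).tendsto_at (mem_univ _)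
    constructor
    · intro t ht
      have h := tendstoLocallyUniformly_comp_add (hsl t ht) (hslice p hp t ht) hck
      exact h
    · have h1 : TendstoLocallyUniformly (fun k x => (ps k).2 (x + σ' • e₀)) (fun x => p.2 (x + σ' • e₀)) atTop :=
        tendstoLocallyUniformly_comp_add htag (hobs p hp) (tendsto_const_nhds (x := σ' • e₀))
      have h2 : TendstoLocallyUniformly (fun k (_ : EuclideanSpace ℝ (Fin 3)) => (ps k).2 (σ' • e₀)) (fun _ => p.2 (σ' • e₀)) atTop :=
        (hck.tendstoUniformly_const).tendstoLocallyUniformly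
      exact h1.sub h2
  -- ## (Ω4) sequentially compact-and-closed: the diagonal over the hull step
  have hcpt : ∀ ps : ℕ → (ℝ → EuclideanSpace ℝ (Fin 3) → EuclideanSpace ℝ (Fin 3)) × (EuclideanSpace ℝ (Fin 3) → EuclideanSpace ℝ (Fin 3)), (∀ k, ps k ∈ Ω) →
      ∃ (φ : ℕ → ℕ) (p : (ℝ → EuclideanSpace ℝ (Fin 3) → EuclideanSpace ℝ (Fin 3)) × (EuclideanSpace ℝ (Fin 3) → EuclideanSpace ℝ (Fin 3))), StrictMono φ ∧ p ∈ Ω ∧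
        (∀ t < 0, TendstoLocallyUniformly (fun j => (ps (φ j)).1 t) (p.1 t) atTop) ∧
        TendstoLocallyUniformly (fun j => (ps (φ j)).2) p.2 atTop := by
    intro ps hps
    choose Γs hgs hREs ss hsls hbrs using fun k => (hps k).2.2.2
    have hPKs : ∀ k, _ := fun k => (hps k).1
    -- the compact slabs
    let Sn : ℕ → Set (ℝ × EuclideanSpace ℝ (Fin 3)) := fun n => Icc (-((n : ℝ) + 2)) (-((n : ℝ) + 2)⁻¹) ×ˢ closedBall (0 : EuclideanSpace ℝ (Fin 3)) ((n : ℝ) + 2)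
    have hn2 : ∀ n : ℕ, (1 : ℝ) ≤ (n : ℝ) + 2 := fun n => by have := n.cast_nonneg (α := ℝ); linarith
    -- slab-uniform convergence of the witnesses
    have hslabk : ∀ k n, TendstoUniformlyOn (fun j (q : ℝ × EuclideanSpace ℝ (Fin 3)) => v q.1 (q.2 + γ (ss k j))) (uncurry (ps k).1) atTop (Sn n) :=
      fun k n => tendstoUniformlyOn_slab C (u := fun j t x => v t (x + γ (ss k j))) (U := (ps k).1) (fun j => (hcT _).1) (fun j => (hcT _).2.1)
        (fun j => (hcT _).2.2.1) (fun j => (hcT _).2.2.2) (hcls4 _ (hps k)).1 (hcls4 _ (hps k)).2.1 (hcls4 _ (hps k)).2.2.1 (hcls4 _ (hps k)).2.2.2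
        (fun t ht x => (hsls k t ht).tendsto_comp ((hslice _ (hps k) t ht).continuousAt) tendsto_const_nhds) (hn2 n)
    have hIk : ∀ k n, TendstoUniformlyOn (fun j σ' => γ (ss k j + σ') - γ (ss k j)) (Γs k) atTop (Icc (-((n : ℝ) + 2)) ((n : ℝ) + 2)) :=
      fun k n => (tendstoLocallyUniformly_iff_forall_isCompact.1 (hbrs k)) _ isCompact_Icc
    -- the diagonal choice
    have hchoice : ∀ k : ℕ, ∃ j : ℕ,
        (∀ q ∈ Sn k, dist ((ps k).1 q.1 q.2) (v q.1 (q.2 + γ (ss k j))) < 1 / ((k : ℝ) + 1)) ∧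
        (∀ σ' ∈ Icc (-((k : ℝ) + 2)) ((k : ℝ) + 2), dist (Γs k σ') (γ (ss k j + σ') - γ (ss k j)) < 1 / ((k : ℝ) + 1)) := by
      intro k
      have hε : (0 : ℝ) < 1 / ((k : ℝ) + 1) := by positivity
      have h2 := Metric.tendstoUniformlyOn_iff.1 (hslabk k k) _ hε
      have h3 := Metric.tendstoUniformlyOn_iff.1 (hIk k k) _ hε
      obtain ⟨j, hj2, hj3⟩ := (h2.and h3).exists
      exact ⟨j, fun q hq => hj2 q hq, fun σ' hσ' => hj3 σ' hσ'⟩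
    choose js hjs using hchoice
    -- the hull step along the chosen base points
    obtain ⟨φ, U, Γ, hφ, hPKU, hPLU, hNU, hconvU, hptU, -, -, hcritU, hΓsU, hΓ0U, hΓplU, hΓunU, hΓhotU, hκU⟩ :=
      exists_hullLimit_branch_reentry C v ⟨hrate, hcont, hmild, hdivf, hpol, hN, hpin, hgrad0, hpins⟩ hK hσ hγ2 hplane hunit hhot hν hκ₀ hκ
        (fun k => ss k (js k))
    have hbrU : TendstoLocallyUniformly (fun j σ' => γ ((fun k => ss k (js k)) (φ j) + σ') - γ ((fun k => ss k (js k)) (φ j))) Γ atTop :=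
      tendstoLocallyUniformly_of_lipschitz_tendsto (fun j => hGL _) hptU
    have hpU : ((U, fun x => Γ (x 0)) : (ℝ → EuclideanSpace ℝ (Fin 3) → EuclideanSpace ℝ (Fin 3)) × (EuclideanSpace ℝ (Fin 3) → EuclideanSpace ℝ (Fin 3))) ∈ Ω :=
      ⟨hPKU, hPLU, hNU, Γ, rfl, ⟨hcritU, hΓsU, hΓ0U, hΓplU, hΓunU, hΓhotU, hκU⟩, fun j => ss (φ j) (js (φ j)), hconvU, hbrU⟩
    have hUc : ∀ t < 0, Continuous (U t) := fun t ht => continuous_slice_of_class hPKU.1 hPKU.2.1 hPKU.2.2.1 hPKU.2.2.2.1 ht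
    -- slab-uniform convergence of the chosen slides to `U`
    have hslabU : ∀ n, TendstoUniformlyOn (fun j (q : ℝ × EuclideanSpace ℝ (Fin 3)) => v q.1 (q.2 + γ (ss (φ j) (js (φ j))))) (uncurry U) atTop (Sn n) :=
      fun n => tendstoUniformlyOn_slab C (u := fun j t x => v t (x + γ (ss (φ j) (js (φ j))))) (U := U) (fun j => (hcT _).1) (fun j => (hcT _).2.1)
        (fun j => (hcT _).2.2.1) (fun j => (hcT _).2.2.2) hPKU.1 hPKU.2.1 hPKU.2.2.1 hPKU.2.2.2.1
        (fun t ht x => (hconvU t ht).tendsto_comp ((hUc t ht).continuousAt) tendsto_const_nhds) (hn2 n)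
    have hIU : ∀ n, TendstoUniformlyOn (fun j σ' => γ (ss (φ j) (js (φ j)) + σ') - γ (ss (φ j) (js (φ j)))) Γ atTop
        (Icc (-((n : ℝ) + 2)) ((n : ℝ) + 2)) :=
      fun n => (tendstoLocallyUniformly_iff_forall_isCompact.1 hbrU) _ isCompact_Icc
    refine ⟨φ, (U, fun x => Γ (x 0)), hφ, hpU, ?_, ?_⟩
    · -- slices
      intro t ht
      rw [tendstoLocallyUniformly_iff_forall_isCompact]
      intro Kc hKc
      obtain ⟨r, hr⟩ := hKc.isBounded.subset_closedBall 0
      obtain ⟨n, hn⟩ := exists_nat_ge (max (max r (-t)) (-t)⁻¹)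
      have hnr : r ≤ (n : ℝ) + 2 := by linarith [le_max_left (max r (-t)) (-t)⁻¹, le_max_left r (-t)]
      have ht1 : -((n : ℝ) + 2) ≤ t := by linarith [le_max_left (max r (-t)) (-t)⁻¹, le_max_right r (-t)]
      have ht2 : t ≤ -((n : ℝ) + 2)⁻¹ := by
        have h1 : (-t)⁻¹ ≤ (n : ℝ) + 2 := by linarith [le_max_right (max r (-t)) (-t)⁻¹]
        have h2 : ((n : ℝ) + 2)⁻¹ ≤ -t := inv_le_of_inv_le₀ (by linarith) h1
        linarith
      rw [Metric.tendstoUniformlyOn_iff]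
      intro ε hε
      obtain ⟨m, hm⟩ := exists_nat_gt (2 / ε)
      have hU' := Metric.tendstoUniformlyOn_iff.1 (hslabU n) (ε / 2) (half_pos hε)
      filter_upwards [hU', eventually_ge_atTop (max n m)] with j hj hjm x hx
      have hjn : n ≤ φ j := le_trans (le_trans (le_max_left _ _) hjm) (hφ.id_le j)
      have hjm' : m ≤ φ j := le_trans (le_trans (le_max_right _ _) hjm) (hφ.id_le j)
      have hp : (t, x) ∈ Sn n := mem_prod.2 ⟨⟨ht1, ht2⟩, closedBall_subset_closedBall hnr (hr hx)⟩
      have hpj : (t, x) ∈ Sn (φ j) := by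
        have hnj : (n : ℝ) + 2 ≤ (φ j : ℝ) + 2 := by have := Nat.cast_le (α := ℝ).2 hjn; linarith
        refine mem_prod.2 ⟨⟨by linarith, le_trans ht2 ?_⟩, closedBall_subset_closedBall (hnr.trans hnj) (hr hx)⟩
        rw [neg_le_neg_iff]
        exact inv_anti₀ (by linarith [hn2 n]) hnj
      have hsmall : 1 / ((φ j : ℝ) + 1) < ε / 2 := by
        have hj1 : (2 / ε : ℝ) < (φ j : ℝ) + 1 := by
          have := Nat.cast_le (α := ℝ).2 hjm'
          linarith
        rw [div_lt_iff₀ (by positivity)]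
        rw [div_lt_iff₀ hε] at hj1
        linarith
      calc dist (U t x) ((ps (φ j)).1 t x)
          ≤ dist (U t x) (v t (x + γ (ss (φ j) (js (φ j))))) + dist (v t (x + γ (ss (φ j) (js (φ j))))) ((ps (φ j)).1 t x) := dist_triangle _ _ _
        _ < ε / 2 + ε / 2 := by
            refine add_lt_add (hj (t, x) hp) ?_
            rw [dist_comm]
            exact (((hjs (φ j)).1 (t, x) hpj).trans hsmall)
        _ = ε := add_halves ε
    · -- tags
      have hconvΓ : TendstoLocallyUniformly (fun j => Γs (φ j)) Γ atTop := by
        rw [tendstoLocallyUniformly_iff_forall_isCompact]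
        intro Kc hKc
        obtain ⟨r, hr⟩ := hKc.isBounded.subset_closedBall 0
        obtain ⟨n, hn⟩ := exists_nat_ge r
        have hnr : r ≤ (n : ℝ) + 2 := by linarith
        have hKI : Kc ⊆ Icc (-((n : ℝ) + 2)) ((n : ℝ) + 2) := fun s hs => by
          have h := hr hs
          rw [mem_closedBall, dist_zero_right, Real.norm_eq_abs] at h
          exact ⟨by linarith [(abs_le.1 (h.trans hnr)).1], (abs_le.1 (h.trans hnr)).2⟩
        rw [Metric.tendstoUniformlyOn_iff]
        intro ε hε
        obtain ⟨m, hm⟩ := exists_nat_gt (2 / ε)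
        have hU' := Metric.tendstoUniformlyOn_iff.1 (hIU n) (ε / 2) (half_pos hε)
        filter_upwards [hU', eventually_ge_atTop (max n m)] with j hj hjm s hs
        have hjn : n ≤ φ j := le_trans (le_trans (le_max_left _ _) hjm) (hφ.id_le j)
        have hjm' : m ≤ φ j := le_trans (le_trans (le_max_right _ _) hjm) (hφ.id_le j)
        have hsI : s ∈ Icc (-((n : ℝ) + 2)) ((n : ℝ) + 2) := hKI hs
        have hsIj : s ∈ Icc (-((φ j : ℝ) + 2)) ((φ j : ℝ) + 2) := by
          have hnj : (n : ℝ) + 2 ≤ (φ j : ℝ) + 2 := by have := Nat.cast_le (α := ℝ).2 hjn; linarith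
          exact ⟨by linarith [hsI.1], hsI.2.trans hnj⟩
        have hsmall : 1 / ((φ j : ℝ) + 1) < ε / 2 := by
          have hj1 : (2 / ε : ℝ) < (φ j : ℝ) + 1 := by
            have := Nat.cast_le (α := ℝ).2 hjm'
            linarith
          rw [div_lt_iff₀ (by positivity)]
          rw [div_lt_iff₀ hε] at hj1
          linarith
        calc dist (Γ s) (Γs (φ j) s)
            ≤ dist (Γ s) (γ (ss (φ j) (js (φ j)) + s) - γ (ss (φ j) (js (φ j)))) +
                dist (γ (ss (φ j) (js (φ j)) + s) - γ (ss (φ j) (js (φ j)))) (Γs (φ j) s) := dist_triangle _ _ _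
          _ < ε / 2 + ε / 2 := by
              refine add_lt_add (hj s hsI) ?_
              rw [dist_comm]
              exact (((hjs (φ j)).2 s hsIj).trans hsmall)
          _ = ε := add_halves ε
      have e : (fun j => (ps (φ j)).2) = fun j => fun x : EuclideanSpace ℝ (Fin 3) => Γs (φ j) (x 0) := funext fun j => hgs (φ j)
      rw [e]
      exact tendstoLocallyUniformly_tag hconvΓ
  -- ## Birkhoff on the branch hull
  obtain ⟨pstar, hpΩ, hrec⟩ := exists_recurrent_of_pairAction C Ω hne hcls hobs hcpt Φ hinv hadd hcontΦ
  obtain ⟨Ustar, gstar⟩ := pstar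
  obtain ⟨hPKs, hPLs, hNs, Γstar, hgs, hREs, sstar, hsls, hbrs⟩ := hpΩ
  simp only at hPKs hPLs hNs hgs hREs hsls hrec
  subst hgs
  refine ⟨sstar, Ustar, Γstar, hPKs, hPLs, hNs, hsls, hbrs, hREs, fun ε hε n => ?_⟩
  obtain ⟨L, hL, hwin⟩ := hrec ε hε n
  refine ⟨L, hL, fun a => ?_⟩
  obtain ⟨σ', hσ', h1, h2⟩ := hwin a
  refine ⟨σ', hσ', fun t ht x hx => ?_, fun s hs => ?_⟩
  · have h := h1 t ht x hx
    simpa [hΦ, he₀] using h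
  · have hx : s • e₀ ∈ closedBall (0 : EuclideanSpace ℝ (Fin 3)) ((n : ℝ) + 2) := by
      have hns : ‖s • e₀‖ = |s| := by simp [he₀, norm_smul]
      rw [mem_closedBall, dist_zero_right, hns]
      exact abs_le.2 ⟨by linarith [hs.1], hs.2⟩
    have h := h2 (s • e₀) hx
    simpa [hΦ, he₀, add_comm] using h

end Summit.NavierStokesRegularity.NavierStokesRegularity.Theorems.PoloidalWindowDoorLrcModEntireRidgeWebRecurrentHull

end
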